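import Summits.AnomalousDissipation.AnomalousDissipation.Theorems.SolenoidalFractalHomogenisationLagrangianStepVmodFrameDefs
import Literature.Analysis.FluidPDE.PassiveVectorTensorDistortedDuality
import Literature.Analysis.FluidPDE.PassiveVectorTensorPropagatorEnergy
import HarnessLib

/-!
# K1L_D (stmt-AnomalousDissipation-27980), (ℓ3-A) road A: (D-GEN) — a DISTORTED propagator tested against an admissible time-Lipschitz field
# from the frame reset: the generator-level (short-window) bound
(helper; `--supports 27980 --as helper`; prover ad-k1loc-p3 g11; first brick of the distorted blocks `BlockBoundGF` per memo L19 (2) /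
tenure 13:35:53Z «(D-GEN) = the distorted twin of `IsPropagator.abs_inner_sub_inner_le_of_steadyTest` (p709724) at the reset window `s = 0`,
over `IsDistortedPropagator` with `hsol` as a LOCAL hypothesis spelled as L22 §4».)

CONVENTION (D28-8′ line-1 rule): derivative-index distortion `Torus.Visc4.conj`, test operator `Torus.viscAdjVar (fun y => conj (G t y) 𝔸)`, class
variable `v = u ∘ X`, constraint `∇·(G v) = 0` (`Torus.distort`).

For an abstract distorted propagator `IsDistortedPropagator Tw 𝔸 b G U` (`…CellClauseModDefs`) whose frame is AT REST at the reset (`G 0 = 1`),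
the v2 existence clause `hsol` (L22 §4 bytes, the future field of `IsDistortedPropagatorS`), a frame `G` with `C¹` slices and `G`, `∂_yG` jointly
continuous (integrability of the weak integrand, `…DistortedDuality` §6), and an ADMISSIBLE FIELD `ψ` on `[0,Tw]` — smooth slices, all iterated
space derivatives jointly continuous, Lipschitz in time uniformly in space, `∇·(G(t)ψ(t)) = 0` for every `t`, with an a.e.-in-time derivative `ψ'`
— and a constant `N ≥ 0` dominating `‖ψ' + (b·∇)ψ + 𝓛^{G,*}_𝔸 ψ‖_{L²}` for a.e. `τ ∈ (0,Tw)`: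
* `IsDistortedPropagator.apply_eq_apply_starProjection_reset` — `U 0 t y = U 0 t (P y)`, `P` the flat Leray projection (`G 0 = 1`);
* `IsDistortedPropagator.continuousOn_inner_toLp` — `t ↦ ⟪U 0 t y, ψ(t)⟫` is continuous on `[0,Tw]` (weak continuity of the orbit × `L²`-Lipschitz test);
* **`IsDistortedPropagator.abs_inner_sub_inner_le_of_lipschitzTest`** (+ `…_frame` over `IsFrameModulation`, with `IsFrameModulation.continuous_uncurry_entry`, `….isContDiff_one_entry`) — `|⟪U 0 t y, ψ(t)⟫ − ⟪y, ψ(0)⟫| ≤ t·N·‖y‖` for every `t ∈ [0,Tw]`, `y ∈ V2`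
  (du Bois-Reymond form of the distorted weak formulation, `IsWeakTensorPassiveVectorDistortedOn.ae_integral_inner_lipschitzField_eq`, on ONE
  solution from `P y` supplied by `hsol`, which `U` represents (`IsDistortedPropagator.repr`); integrand `≤ N‖U 0 τ (P y)‖ ≤ N‖y‖` by Cauchy–Schwarz
  and contraction; a.e. `t` ⟹ every `t ≤ Tw` by the continuity above — no longer-horizon propagator is needed).
The flat tool is the case `G ≡ 1`, `ψ(t) = ψ(0)` steady.  Which admissible fields the block provers use (frame transports of slow solenoidal
tests; co-moving corrected modes of `…DistortedFramePairing`) is NOT decided here.  FLAG for the texts: the abstract class `IsFrameModulation`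
gives `C^∞` slices and time-Lipschitz entries but not literally the joint continuity of `∂_yG` used for the integrability discharge — free for
the one instance (`frameG` of the clamped exact flow), to be exposed by the instance provider or added as a field if a block needs it.
`sorry`-free; NOT a proof of any block, of (M_θ), of `stub_Vmod_EHTthg`, of K1L_D or of AD; rung F-D1.A0.
-/

set_option linter.dupNamespace false

noncomputable section

namespace Summit.AnomalousDissipation.AnomalousDissipation.Theorems.SolenoidalFractalHomogenisation.LagrangianStep.CellClauseMod

open Literature.Analysis Literature.Analysis.FluidPDE Literature.Analysis.FunctionSpaces
open MeasureTheory Set Filter UnitAddTorus Function Topology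
open scoped ENNReal NNReal InnerProductSpace

variable {Tw : ℝ} {𝔸 : Torus.Visc4 (Fin 3)} {b : ℝ → VF} {G : ℝ → UnitAddTorus (Fin 3) → Matrix (Fin 3) (Fin 3) ℝ}
  {U : ℝ → ℝ → (V2 →L[ℝ] V2)}

/-- The `L²` pairing of two `L²` representatives is the inner product of their classes. -/
private theorem integral_inner_eq_inner_toLp' {f g : VF} (hf : MemLp f 2 volume) (hg : MemLp g 2 volume) :
    ∫ x, ⟪f x, g x⟫_ℝ = ⟪hf.toLp f, hg.toLp g⟫_ℝ := by
  rw [L2.inner_def]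
  exact integral_congr_ae (by
    filter_upwards [hf.coeFn_toLp, hg.coeFn_toLp] with x hx hy
    rw [hx, hy])

/-- Cauchy–Schwarz for the pairing of an `L²` representative with a field of `L²` norm at most `N`. -/
private theorem abs_integral_inner_le_of_eLpNorm_le' {f g : VF} (hf : MemLp f 2 volume) (hg : MemLp g 2 volume)
    {N : ℝ} (hN0 : 0 ≤ N) (hN : eLpNorm g 2 volume ≤ ENNReal.ofReal N) :
    |∫ x, ⟪f x, g x⟫_ℝ| ≤ ‖hf.toLp f‖ * N := by
  rw [integral_inner_eq_inner_toLp' hf hg]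
  refine (abs_real_inner_le_norm _ _).trans (mul_le_mul_of_nonneg_left ?_ (norm_nonneg _))
  rw [Lp.norm_toLp]
  exact ENNReal.toReal_le_of_le_ofReal hN0 hN

/-- At the frame reset (`G 0 = 1`) the `G(0)`-solenoidal classes are the flat ones. -/
theorem isWeaklyDivFree_distort_reset_iff (hG0 : ∀ y, G 0 y = 1) (z : VF) :
    Torus.IsWeaklyDivFree (Torus.distort (G 0) z) ↔ Torus.IsWeaklyDivFree z := by
  rw [show G 0 = fun _ => (1 : Matrix (Fin 3) (Fin 3) ℝ) from funext hG0, Torus.distort_one]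

/-- **A distorted propagator from the reset sees only the Leray projection of its datum**: `U 0 t y = U 0 t (P y)` when `G 0 = 1`
(`eq_zero_of_orth` on `y − P y`, which is orthogonal to every flat — i.e. `G(0)`- — solenoidal class). -/
theorem IsDistortedPropagator.apply_eq_apply_starProjection_reset (hU : IsDistortedPropagator Tw 𝔸 b G U) (hG0 : ∀ y, G 0 y = 1)
    (t : ℝ) (y : V2) : U 0 t y = U 0 t ((Torus.divFreeL2 (Fin 3)).starProjection y) := by
  set P := (Torus.divFreeL2 (Fin 3)).starProjection with hP
  have h0 : U 0 t (y - P y) = 0 := hU.eq_zero_of_orth 0 t (y - P y) fun z hz =>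
    (Torus.divFreeL2 (Fin 3)).starProjection_inner_eq_zero y z
      ((Torus.mem_divFreeL2_iff z).2 ((isWeaklyDivFree_distort_reset_iff hG0 _).1 hz))
  have h1 : U 0 t y - U 0 t (P y) = 0 := by rw [← map_sub, h0]
  exact sub_eq_zero.1 h1

/-- The `L²` classes of the slices of a field that is Lipschitz in time uniformly in space are Lipschitz in time (`L² ≤ sup` on the
probability space `𝕋³`). -/
theorem norm_toLp_sub_toLp_le {ψ : ℝ → VF} (hψs : ∀ t, Torus.IsSmooth (ψ t))
    {L : ℝ} (hL0 : 0 ≤ L) (hL : ∀ t ∈ Icc 0 Tw, ∀ s ∈ Icc 0 Tw, ∀ y, ‖ψ t y - ψ s y‖ ≤ L * |t - s|)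
    {t s : ℝ} (ht : t ∈ Icc 0 Tw) (hs : s ∈ Icc 0 Tw) :
    ‖((hψs t).memLp 2).toLp (ψ t) - ((hψs s).memLp 2).toLp (ψ s)‖ ≤ L * |t - s| := by
  rw [← MemLp.toLp_sub, Lp.norm_toLp]
  have hB : ∀ y, ‖(ψ t - ψ s) y‖ ≤ L * |t - s| := fun y => hL t ht s hs y
  have h := eLpNorm_le_of_ae_bound (p := (2 : ℝ≥0∞)) (μ := (volume : Measure (UnitAddTorus (Fin 3)))) (f := ψ t - ψ s)
    (Filter.Eventually.of_forall hB)
  have h' : eLpNorm (ψ t - ψ s) 2 volume ≤ ENNReal.ofReal (L * |t - s|) := by simpa using h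
  exact ENNReal.toReal_le_of_le_ofReal (by positivity) h'

/-- **Continuity of the tested orbit**: for a distorted propagator and a field `ψ` Lipschitz in time on `[0,Tw]` uniformly in space,
`t ↦ ⟪U 0 t y, ψ(t)⟫` is continuous on `[0,Tw]` (weak continuity of `t ↦ U 0 t y`, contraction, and the `L²`-Lipschitz bound of the test). -/
theorem IsDistortedPropagator.continuousOn_inner_toLp (hU : IsDistortedPropagator Tw 𝔸 b G U) (hTw : 0 ≤ Tw)
    {ψ : ℝ → VF} (hψs : ∀ t, Torus.IsSmooth (ψ t))
    (hψL : ∃ L : ℝ, 0 ≤ L ∧ ∀ t ∈ Icc 0 Tw, ∀ s ∈ Icc 0 Tw, ∀ y, ‖ψ t y - ψ s y‖ ≤ L * |t - s|) (y : V2) :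
    ContinuousOn (fun t => ⟪U 0 t y, ((hψs t).memLp 2).toLp (ψ t)⟫_ℝ) (Icc 0 Tw) := by
  obtain ⟨L, hL0, hL⟩ := hψL
  set Ψ : ℝ → V2 := fun t => ((hψs t).memLp 2).toLp (ψ t) with hΨ
  intro t₀ ht₀
  -- split `⟪U t y, Ψ t⟫ − ⟪U t₀ y, Ψ t₀⟫ = ⟪U t y, Ψ t − Ψ t₀⟫ + (⟪U t y, Ψ t₀⟫ − ⟪U t₀ y, Ψ t₀⟫)`
  have hsplit : ∀ t, ⟪U 0 t y, Ψ t⟫_ℝ = ⟪U 0 t y, Ψ t - Ψ t₀⟫_ℝ + ⟪U 0 t y, Ψ t₀⟫_ℝ := fun t => by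
    rw [inner_sub_right]; ring
  have e : (fun t => ⟪U 0 t y, ((hψs t).memLp 2).toLp (ψ t)⟫_ℝ) = fun t => ⟪U 0 t y, Ψ t - Ψ t₀⟫_ℝ + ⟪U 0 t y, Ψ t₀⟫_ℝ :=
    funext hsplit
  rw [ContinuousWithinAt, e]
  have hlim0 : ⟪U 0 t₀ y, Ψ t₀ - Ψ t₀⟫_ℝ = 0 := by rw [sub_self, inner_zero_right]
  rw [show ⟪U 0 t₀ y, ((hψs t₀).memLp 2).toLp (ψ t₀)⟫_ℝ = 0 + ⟪U 0 t₀ y, Ψ t₀⟫_ℝ by rw [zero_add]]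
  refine Filter.Tendsto.add ?_ (hU.continuousOn 0 le_rfl hTw y (Ψ t₀) t₀ ht₀)
  -- the first piece is dominated by `‖y‖·L·|t − t₀|`
  have hbd : ∀ t ∈ Icc 0 Tw, |⟪U 0 t y, Ψ t - Ψ t₀⟫_ℝ| ≤ ‖y‖ * (L * |t - t₀|) := fun t ht =>
    (abs_real_inner_le_norm _ _).trans (mul_le_mul (hU.norm_le 0 t y) (norm_toLp_sub_toLp_le hψs hL0 hL ht ht₀) (norm_nonneg _) (norm_nonneg _))
  have hg : Tendsto (fun t => ‖y‖ * (L * |t - t₀|)) (𝓝[Icc 0 Tw] t₀) (𝓝 0) := by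
    have hc : Continuous fun t : ℝ => ‖y‖ * (L * |t - t₀|) := by fun_prop
    have h0 : ‖y‖ * (L * |t₀ - t₀|) = 0 := by simp
    rw [← h0]
    exact (hc.tendsto t₀).mono_left nhdsWithin_le_nhds
  refine squeeze_zero_norm' ?_ hg
  filter_upwards [self_mem_nhdsWithin] with t ht
  rw [Real.norm_eq_abs]; exact hbd t ht

set_option maxHeartbeats 1600000 in
/-- **(D-GEN) THE DISTORTED PROPAGATOR TESTED AGAINST AN ADMISSIBLE TIME-LIPSCHITZ FIELD, from the frame reset** (generator-level bound):
`|⟪U 0 t y, ψ(t)⟫ − ⟪y, ψ(0)⟫| ≤ t · N · ‖y‖` for every `t ∈ [0,Tw]` and every `y ∈ V2`.  See the module docstring.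
[cite: DiPernaLions1989, §II.1 (12)–(14)] [cite: Temam1997, Ch. II §3.1–3.2, (3.2)–(3.5), Thm. 3.1] -/
theorem IsDistortedPropagator.abs_inner_sub_inner_le_of_lipschitzTest (hU : IsDistortedPropagator Tw 𝔸 b G U)
    (hsol : ∀ s, 0 ≤ s → s < Tw → ∀ (φ : VF) (hφ : MemLp φ 2 volume), Torus.IsWeaklyDivFree (Torus.distort (G s) φ) → ∃ w : ℝ → VF,
      Torus.IsWeakTensorPassiveVectorDistortedOn 0 (Tw - s) 𝔸 (fun τ => b (s + τ)) (fun τ => G (s + τ)) φ w)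
    (hG0 : ∀ y, G 0 y = 1)
    (hG1 : ∀ t i j, Torus.IsContDiff 1 (fun y => G t y i j))
    (hGc : ∀ i j, Continuous (uncurry fun t y => G t y i j))
    (hGd : ∀ i j e', Continuous (uncurry fun t y => Torus.partialDeriv e' (fun y => G t y i j) y))
    {ψ ψ' : ℝ → VF} (hψs : ∀ t, Torus.IsSmooth (ψ t))
    (hψc : ∀ l : List (Fin 3), Continuous (uncurry fun t y => Torus.iterPartialDeriv l (ψ t) y))
    (hψL : ∃ L : ℝ, 0 ≤ L ∧ ∀ t ∈ Icc 0 Tw, ∀ s ∈ Icc 0 Tw, ∀ y, ‖ψ t y - ψ s y‖ ≤ L * |t - s|)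
    (hψdiv : ∀ t, Torus.IsDivFree (Torus.distort (G t) (ψ t)))
    (hψ' : ∀ᵐ t ∂(volume.restrict (Ioo 0 Tw)), ∀ y, HasDerivAt (fun s => ψ s y) (ψ' t y) t)
    {N : ℝ} (hN0 : 0 ≤ N)
    (hN : ∀ᵐ τ ∂(volume.restrict (Ioo 0 Tw)),
      MemLp (fun x => ψ' τ x + Torus.convect (b τ) (ψ τ) x + Torus.viscAdjVar (fun y => Torus.Visc4.conj (G τ y) 𝔸) (ψ τ) x) 2 volume ∧
      eLpNorm (fun x => ψ' τ x + Torus.convect (b τ) (ψ τ) x + Torus.viscAdjVar (fun y => Torus.Visc4.conj (G τ y) 𝔸) (ψ τ) x) 2 volume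
        ≤ ENNReal.ofReal N)
    {t : ℝ} (ht : t ∈ Icc 0 Tw) (y : V2) :
    |⟪U 0 t y, ((hψs t).memLp 2).toLp (ψ t)⟫_ℝ - ⟪y, ((hψs 0).memLp 2).toLp (ψ 0)⟫_ℝ| ≤ t * N * ‖y‖ := by
  set Ψ : ℝ → V2 := fun t => ((hψs t).memLp 2).toLp (ψ t) with hΨdef
  -- only the Leray projection of `y` is seen on both sides
  set P := (Torus.divFreeL2 (Fin 3)).starProjection with hPdef
  set y' := P y with hy'def
  have hy'w : Torus.IsWeaklyDivFree ((y' : V2) : VF) := Torus.isWeaklyDivFree_starProjection y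
  have hψ0div : Torus.IsDivFree (ψ 0) := by
    have h := hψdiv 0
    rwa [show G 0 = fun _ => (1 : Matrix (Fin 3) (Fin 3) ℝ) from funext hG0, Torus.distort_one] at h
  have hΨ0 : Ψ 0 ∈ Torus.divFreeL2 (Fin 3) :=
    (Torus.mem_divFreeL2_iff _).2 ((hψ0div.isWeaklyDivFree_holds (hψs 0)).congr_ae (MemLp.coeFn_toLp _).symm)
  have hUy : U 0 t y = U 0 t y' := hU.apply_eq_apply_starProjection_reset hG0 t y
  have hyΨ : ⟪y, Ψ 0⟫_ℝ = ⟪y', Ψ 0⟫_ℝ := by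
    have h0 : ⟪y - y', Ψ 0⟫_ℝ = 0 := (Torus.divFreeL2 (Fin 3)).starProjection_inner_eq_zero y (Ψ 0) hΨ0
    rw [inner_sub_left] at h0
    linarith
  have hny : ‖y'‖ ≤ ‖y‖ := (Torus.divFreeL2 (Fin 3)).norm_starProjection_apply_le y
  show |⟪U 0 t y, Ψ t⟫_ℝ - ⟪y, Ψ 0⟫_ℝ| ≤ t * N * ‖y‖
  rw [hUy, hyΨ]
  refine le_trans ?_ (mul_le_mul_of_nonneg_left hny (mul_nonneg ht.1 hN0))
  -- the case `Tw = 0` (then `t = 0`)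
  rcases eq_or_lt_of_le (ht.1.trans ht.2) with hTw0 | hTw
  · have ht0 : t = 0 := le_antisymm (hTw0 ▸ ht.2) ht.1
    subst ht0
    rw [hU.self_of_divFree 0 le_rfl (by linarith) y' ((isWeaklyDivFree_distort_reset_iff hG0 _).2 hy'w), sub_self, abs_zero, zero_mul, zero_mul]
  -- ONE distorted weak solution from `y'` on `[0, Tw)`, represented by `U`
  set φ : VF := ((y' : V2) : VF) with hφdef
  have hφ : MemLp φ 2 volume := Lp.memLp y'
  have hyφ : hφ.toLp φ = y' := Lp.toLp_coeFn y' hφ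
  have hφG : Torus.IsWeaklyDivFree (Torus.distort (G 0) φ) := (isWeaklyDivFree_distort_reset_iff hG0 _).2 hy'w
  obtain ⟨w, hw0⟩ := hsol 0 le_rfl hTw φ hφ hφG
  have hrep0 := hU.repr 0 le_rfl hTw φ hφ hφG w hw0
  have hrep : ∀ᵐ τ ∂(volume.restrict (Ioo 0 Tw)), ∃ hτ : MemLp (w τ) 2 volume, hτ.toLp (w τ) = U 0 τ (hφ.toLp φ) := by
    simpa only [zero_add, sub_zero] using hrep0
  have hw : Torus.IsWeakTensorPassiveVectorDistortedOn 0 Tw 𝔸 b G φ w := by simpa only [zero_add, sub_zero] using hw0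
  -- the pairing identity with the admissible field `ψ` (time derivative `timeDeriv ψ = ψ'` a.e.)
  have hψ'' : ∀ᵐ τ ∂(volume.restrict (Ioo 0 Tw)), ∀ x, HasDerivAt (fun s => ψ s x) (Torus.timeDeriv ψ τ x) τ := by
    filter_upwards [hψ'] with τ hτ x
    have e : Torus.timeDeriv ψ τ x = ψ' τ x := (hτ x).deriv
    rw [e]; exact hτ x
  have hint := hw.integrable_weakIntegrand_lipschitzField hψs hψc hψL hG1 hGc hGd 𝔸
  have hid := hw.ae_integral_inner_lipschitzField_eq hψs hψc hψL hψdiv hψ'' hint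
  -- the bound on the integrand, a.e. in time
  set Φ : ℝ → ℝ := fun σ =>
    ∫ x, (⟪w σ x, Torus.timeDeriv ψ σ x + Torus.convect (b σ) (ψ σ) x + Torus.viscAdjVar (fun y => Torus.Visc4.conj (G σ y) 𝔸) (ψ σ) x⟫_ℝ +
      0 * ⟪b σ x, Torus.convect (w σ) (ψ σ) x⟫_ℝ) with hΦdef
  have hΦle : ∀ᵐ σ ∂(volume.restrict (Ioo 0 Tw)), ‖Φ σ‖ ≤ N * ‖y'‖ := by
    filter_upwards [hrep, hN, hψ'] with σ hσ hNσ hdσ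
    obtain ⟨hm, he⟩ := hσ
    have hd' : ∀ x, Torus.timeDeriv ψ σ x = ψ' σ x := fun x => by simp only [Torus.timeDeriv, (hdσ x).deriv]
    rw [hΦdef]
    simp only [zero_mul, add_zero, hd']
    rw [Real.norm_eq_abs]
    have h1 := abs_integral_inner_le_of_eLpNorm_le' hm hNσ.1 hN0 hNσ.2
    rw [he, hyφ] at h1
    calc |∫ x, ⟪w σ x, ψ' σ x + Torus.convect (b σ) (ψ σ) x + Torus.viscAdjVar (fun y => Torus.Visc4.conj (G σ y) 𝔸) (ψ σ) x⟫_ℝ|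
        ≤ ‖U 0 σ y'‖ * N := h1
      _ ≤ ‖y'‖ * N := mul_le_mul_of_nonneg_right (hU.norm_le _ _ _) hN0
      _ = N * ‖y'‖ := mul_comm _ _
  -- a.e. `τ ∈ (0, Tw)`: the bound at time `τ`
  have hae : ∀ᵐ τ ∂(volume.restrict (Ioo 0 Tw)), |⟪U 0 τ y', Ψ τ⟫_ℝ - ⟪y', Ψ 0⟫_ℝ| ≤ τ * N * ‖y'‖ := by
    filter_upwards [hrep, hid, ae_restrict_mem measurableSet_Ioo] with τ hτr hτi hτm
    obtain ⟨hm, he⟩ := hτr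
    have e1 : ⟪U 0 τ y', Ψ τ⟫_ℝ = ∫ x, ⟪w τ x, ψ τ x⟫_ℝ := by
      rw [hΨdef, integral_inner_eq_inner_toLp' hm ((hψs τ).memLp 2), he, hyφ]
    have e2 : ⟪y', Ψ 0⟫_ℝ = ∫ x, ⟪φ x, ψ 0 x⟫_ℝ := by
      rw [hΨdef, integral_inner_eq_inner_toLp' hφ ((hψs 0).memLp 2), hyφ]
    rw [e1, e2, hτi, add_sub_cancel_left]
    have hΦτ : ∀ᵐ σ ∂(volume.restrict (Ioc 0 τ)), ‖Φ σ‖ ≤ N * ‖y'‖ := by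
      rw [← Measure.restrict_congr_set Ioo_ae_eq_Ioc]
      exact ae_restrict_of_ae_restrict_of_subset (Ioo_subset_Ioo le_rfl hτm.2.le) hΦle
    have key := norm_setIntegral_le_of_norm_le_const_ae (measure_Ioc_lt_top (a := (0:ℝ)) (b := τ)) hΦτ
    rw [Real.norm_eq_abs, Measure.real, Real.volume_Ioc, sub_zero, ENNReal.toReal_ofReal hτm.1.le] at key
    calc |∫ σ in Ioc 0 τ, Φ σ| ≤ N * ‖y'‖ * τ := key
      _ = τ * N * ‖y'‖ := by ring
  -- every `t ∈ [0, Tw]` by continuity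
  have hf : ContinuousOn (fun τ => |⟪U 0 τ y', Ψ τ⟫_ℝ - ⟪y', Ψ 0⟫_ℝ|) (Icc 0 Tw) :=
    ((hU.continuousOn_inner_toLp hTw.le hψs hψL y').sub continuousOn_const).abs
  have hg : ContinuousOn (fun τ => τ * N * ‖y'‖) (Icc 0 Tw) := ((continuous_id.mul continuous_const).mul continuous_const).continuousOn
  exact Torus.le_on_Icc_of_ae_le_of_continuousOn₂ hTw hf hg hae t ht

/-! ## Over the class of record `IsFrameModulation` -/

/-- The entries of a frame modulation are jointly continuous on `ℝ × 𝕋³` (clamped to the window: smooth slices, uniformly Lipschitz in time). -/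
theorem IsFrameModulation.continuous_uncurry_entry {θ nC : ℝ} (hG : IsFrameModulation θ Tw nC G) (hTw : 0 ≤ Tw) (i j : Fin 3) :
    Continuous (uncurry fun t y => G t y i j) := by
  obtain ⟨L, hL⟩ := hG.lipschitz
  have hmem : ∀ t : ℝ, max 0 (min t Tw) ∈ Icc 0 Tw := fun t => ⟨le_max_left _ _, max_le hTw (min_le_right _ _)⟩
  refine continuous_prod_of_continuous_lipschitzWith (uncurry fun t y => G t y i j) L (fun t => ?_) (fun y => ?_)
  · have hs := (hG.smooth _ (hmem t) i j).continuous
    have e : (fun y => uncurry (fun t y => G t y i j) (t, y)) = fun y => G (max 0 (min t Tw)) y i j := by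
      funext y; simp only [uncurry_apply_pair]; rw [hG.clamped t y]
    rw [e]; exact hs
  · refine LipschitzWith.of_dist_le_mul fun t s => ?_
    simp only [uncurry_apply_pair]
    rw [hG.clamped t y, hG.clamped s y]
    refine ((hL y i j).dist_le_mul _ (hmem t) _ (hmem s)).trans (mul_le_mul_of_nonneg_left ?_ L.coe_nonneg)
    rw [Real.dist_eq, Real.dist_eq, max_comm (0:ℝ) (min t Tw), max_comm (0:ℝ) (min s Tw)]
    calc |max (min t Tw) 0 - max (min s Tw) 0| ≤ |min t Tw - min s Tw| := abs_max_sub_max_le_abs _ _ _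
      _ ≤ max |t - s| |Tw - Tw| := abs_min_sub_min_le_max _ _ _ _
      _ = |t - s| := by rw [sub_self, abs_zero, max_eq_left (abs_nonneg _)]

/-- The slices of a frame modulation are `C¹` at every real time (clamped; smooth on the window). -/
theorem IsFrameModulation.isContDiff_one_entry {θ nC : ℝ} (hG : IsFrameModulation θ Tw nC G) (hTw : 0 ≤ Tw) (t : ℝ) (i j : Fin 3) :
    Torus.IsContDiff 1 (fun y => G t y i j) := by
  have hmem : max 0 (min t Tw) ∈ Icc 0 Tw := ⟨le_max_left _ _, max_le hTw (min_le_right _ _)⟩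
  have e : (fun y => G t y i j) = fun y => G (max 0 (min t Tw)) y i j := by funext y; rw [hG.clamped t y]
  rw [e]; exact (hG.smooth _ hmem i j).isContDiff (by simp)

/-- **(D-GEN) over the class of record**: `IsDistortedPropagator.abs_inner_sub_inner_le_of_lipschitzTest` for a frame modulation datum
`IsFrameModulation θ Tw nC G` (reset `G 0 = 1`, `C¹` slices and joint continuity of the entries come from the class; the joint continuity of
`∂_yG` stays an explicit hypothesis — see the FLAG in the module docstring). -/
theorem IsDistortedPropagator.abs_inner_sub_inner_le_of_lipschitzTest_frame {θ nC : ℝ} (hU : IsDistortedPropagator Tw 𝔸 b G U)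
    (hG : IsFrameModulation θ Tw nC G)
    (hsol : ∀ s, 0 ≤ s → s < Tw → ∀ (φ : VF) (hφ : MemLp φ 2 volume), Torus.IsWeaklyDivFree (Torus.distort (G s) φ) → ∃ w : ℝ → VF,
      Torus.IsWeakTensorPassiveVectorDistortedOn 0 (Tw - s) 𝔸 (fun τ => b (s + τ)) (fun τ => G (s + τ)) φ w)
    (hGd : ∀ i j e', Continuous (uncurry fun t y => Torus.partialDeriv e' (fun y => G t y i j) y))
    {ψ ψ' : ℝ → VF} (hψs : ∀ t, Torus.IsSmooth (ψ t))
    (hψc : ∀ l : List (Fin 3), Continuous (uncurry fun t y => Torus.iterPartialDeriv l (ψ t) y))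
    (hψL : ∃ L : ℝ, 0 ≤ L ∧ ∀ t ∈ Icc 0 Tw, ∀ s ∈ Icc 0 Tw, ∀ y, ‖ψ t y - ψ s y‖ ≤ L * |t - s|)
    (hψdiv : ∀ t, Torus.IsDivFree (Torus.distort (G t) (ψ t)))
    (hψ' : ∀ᵐ t ∂(volume.restrict (Ioo 0 Tw)), ∀ y, HasDerivAt (fun s => ψ s y) (ψ' t y) t)
    {N : ℝ} (hN0 : 0 ≤ N)
    (hN : ∀ᵐ τ ∂(volume.restrict (Ioo 0 Tw)),
      MemLp (fun x => ψ' τ x + Torus.convect (b τ) (ψ τ) x + Torus.viscAdjVar (fun y => Torus.Visc4.conj (G τ y) 𝔸) (ψ τ) x) 2 volume ∧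
      eLpNorm (fun x => ψ' τ x + Torus.convect (b τ) (ψ τ) x + Torus.viscAdjVar (fun y => Torus.Visc4.conj (G τ y) 𝔸) (ψ τ) x) 2 volume
        ≤ ENNReal.ofReal N)
    {t : ℝ} (ht : t ∈ Icc 0 Tw) (y : V2) :
    |⟪U 0 t y, ((hψs t).memLp 2).toLp (ψ t)⟫_ℝ - ⟪y, ((hψs 0).memLp 2).toLp (ψ 0)⟫_ℝ| ≤ t * N * ‖y‖ :=
  have hTw : 0 ≤ Tw := ht.1.trans ht.2
  hU.abs_inner_sub_inner_le_of_lipschitzTest hsol hG.init (fun t i j => hG.isContDiff_one_entry hTw t i j)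
    (fun i j => hG.continuous_uncurry_entry hTw i j) hGd hψs hψc hψL hψdiv hψ' hN0 hN ht y

end Summit.AnomalousDissipation.AnomalousDissipation.Theorems.SolenoidalFractalHomogenisation.LagrangianStep.CellClauseMod

end
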